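import Literature.Barriers.CriticalPhenomena.WeaklySAWQuadraticFlowCutoff
import HarnessLib

/-!
# [BBS-rg-flow, §1.3 / BBS 2015, §7.3]: shifting the cut-off — the hypotheses of Lemmas 2.1–2.2 at a
# cut-off `k` imply them at any cut-off `k'` with `|k - k'| ≤ d`, with constants `BΩ^d, CΩ^d, N + d`

[BBS-rg-flow] fixes the weights `χ_j = Ω^{-(j-j_Ω)₊}` but notes (§1.2, after (1.7)) that "the
value of `j_Ω` is not important … a different choice only changes constants"; BBS 2015, §7.3
(Steps 2–3 of the proof of Proposition 7.1.1) uses the flow theorem with the weights FROZEN at the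
cut-off of a nearby mass `m̃²` ("`χ̃_j = χ_j(m̃²)`" in (Djdef-2)). The elementary fact behind this is
recorded here: `Ω^{-(j-k)₊} ≤ Ω^d·Ω^{-(j-k')₊}` whenever `k ≤ k' + d` (`cutoffWeight_le_pow_mul`), hence
`CutoffGbarHyp`/`CutoffQuadHyp` at `k` give the same structures at `k'` (`|k - k'| ≤ d`) with `B, C`
multiplied by `Ω^d` and at most `d` more exceptional scales (`CutoffGbarHyp.shift`,
`CutoffQuadHyp.shift`; the smallness conditions on `g₀` for the new constants are hypotheses).
-/

noncomputable section

open Set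

namespace Literature.Barriers.CriticalPhenomena

namespace CTWSAW

/-- **`Ω^{-(j-k)₊} ≤ Ω^d·Ω^{-(j-k')₊}` for `k ≤ k' + d`** (`Ω ≥ 1`). [cite: BauerschmidtBrydgesSlade2015Flow, §1.2–1.3, (1.7)–(1.8) ("the value of j_Ω is not important")] -/
theorem cutoffWeight_le_pow_mul {Ω : ℝ} (hΩ : 1 ≤ Ω) {k k' : ℕ∞} {d : ℕ} (hk : k ≤ k' + d) (j : ℕ) :
    cutoffWeight Ω k j ≤ Ω ^ d * cutoffWeight Ω k' j := by
  have hΩ0 : 0 < Ω := by linarith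
  have h1d : 1 ≤ Ω ^ d := one_le_pow₀ hΩ
  obtain ⟨-, hw1⟩ := cutoffWeight_pos_and_le_one hΩ k j
  induction k' using ENat.recTopCoe with
  | top => rw [cutoffWeight_top, mul_one]; exact hw1.trans h1d
  | coe k' =>
    induction k using ENat.recTopCoe with
    | top =>
      exfalso
      have : ((k' : ℕ∞) + d) < ⊤ := by
        rw [← ENat.coe_add]; exact ENat.coe_lt_top _
      exact absurd hk (not_le.2 this)
    | coe k =>
      have hkk : k ≤ k' + d := by
        rw [← ENat.coe_add] at hk; exact_mod_cast hk
      rw [cutoffWeight_coe, cutoffWeight_coe, ← inv_pow, ← inv_pow]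
      -- `Ω⁻¹ ^ (j-k) ≤ Ω^d · Ω⁻¹ ^ (j-k')`: since `j - k' ≤ (j - k) + d`
      have hle : j - k' ≤ (j - k) + d := by omega
      have hΩi0 : 0 ≤ Ω⁻¹ := by positivity
      have hΩi1 : Ω⁻¹ ≤ 1 := inv_le_one_of_one_le₀ hΩ
      calc Ω⁻¹ ^ (j - k) = Ω ^ d * (Ω⁻¹ ^ d * Ω⁻¹ ^ (j - k)) := by
            rw [← mul_assoc, ← mul_pow, mul_inv_cancel₀ hΩ0.ne', one_pow, one_mul]
        _ = Ω ^ d * Ω⁻¹ ^ ((j - k) + d) := by rw [pow_add, mul_comm (Ω⁻¹ ^ d)]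
        _ ≤ Ω ^ d * Ω⁻¹ ^ (j - k') :=
            mul_le_mul_of_nonneg_left (pow_le_pow_of_le_one hΩi0 hΩi1 hle) (by positivity)

/-- The exceptional scales shift: if `P j` holds for `j ≤ k` off `≤ N` scales, then `P j` holds for
`j ≤ k'` off `≤ N + d` scales whenever `k' ≤ k + d`. [cite: BauerschmidtBrydgesSlade2015Flow, Assumption (A1) ("the number of exceptional scales is bounded")] -/
theorem exc_shift {Pr : ℕ → Prop} {k k' : ℕ∞} {N d : ℕ} (hk : k' ≤ k + d)
    (h : ∃ s : Finset ℕ, s.card ≤ N ∧ ∀ j : ℕ, (j : ℕ∞) ≤ k → j ∉ s → Pr j) :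
    ∃ s : Finset ℕ, s.card ≤ N + d ∧ ∀ j : ℕ, (j : ℕ∞) ≤ k' → j ∉ s → Pr j := by
  classical
  obtain ⟨s, hs, hP⟩ := h
  induction k using ENat.recTopCoe with
  | top => exact ⟨s, hs.trans (Nat.le_add_right _ _), fun j _ hj => hP j le_top hj⟩
  | coe k =>
    -- add the scales `k+1, …, k+d`
    refine ⟨s ∪ Finset.Ico (k + 1) (k + 1 + d), ?_, fun j hj hjs => ?_⟩
    · calc (s ∪ Finset.Ico (k + 1) (k + 1 + d)).card ≤ s.card + (Finset.Ico (k + 1) (k + 1 + d)).card :=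
            Finset.card_union_le _ _
        _ ≤ N + d := by rw [Nat.card_Ico]; omega
    · rw [Finset.mem_union, not_or, Finset.mem_Ico] at hjs
      have hjk : j ≤ k + d := by
        have : (j : ℕ∞) ≤ (k : ℕ∞) + d := hj.trans hk
        rw [← ENat.coe_add] at this; exact_mod_cast this
      have hjle : j ≤ k := by
        by_contra hcon
        exact hjs.2 ⟨by omega, by omega⟩
      exact hP j (by exact_mod_cast hjle) hjs.1

/-- **Shift of the cut-off in the hypotheses of Lemma 2.1**: `CutoffGbarHyp` at `k` gives it at any
`k'` with `k ≤ k' + d`, `k' ≤ k + d`, with `B ↦ BΩ^d`, `N ↦ N + d` (the smallness of `g₀` for the new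
constants being assumed). [cite: BauerschmidtBrydgesSlade2015Flow, Assumption (A1), Lemma 2.1 and §1.2 ("the value of j_Ω is not important")] -/
theorem CutoffGbarHyp.shift {β : ℕ → ℝ} {Ω : ℝ} {k : ℕ∞} {B c : ℝ} {N : ℕ} {g₀ : ℝ}
    (h : CutoffGbarHyp β Ω k B c N g₀) {k' : ℕ∞} {d : ℕ} (hk : k ≤ k' + d) (hk' : k' ≤ k + d)
    {g : ℝ} (hg : 0 < g) (hg4 : g ≤ 1 / 4) (hsmallB : B * Ω ^ d * g ≤ 1 / 4)
    (hsmallN : 2 * (B * Ω ^ d) * g * ((N + d : ℕ) + 1 / (Ω - 1)) ≤ 1 / 2) :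
    CutoffGbarHyp β Ω k' (B * Ω ^ d) c (N + d) g where
  one_lt := h.one_lt
  abs_le j := by
    calc |β j| ≤ B * cutoffWeight Ω k j := h.abs_le j
      _ ≤ B * (Ω ^ d * cutoffWeight Ω k' j) :=
          mul_le_mul_of_nonneg_left (cutoffWeight_le_pow_mul h.one_lt.le hk j) h.B_nonneg
      _ = B * Ω ^ d * cutoffWeight Ω k' j := by ring
  c_pos := h.c_pos
  exc := exc_shift hk' h.exc
  g₀_pos := hg
  g₀_le := hg4
  smallB := hsmallB
  smallN := hsmallN

/-- **Shift of the cut-off in the hypotheses of Lemma 2.2**: `CutoffQuadHyp` at `k` gives it at any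
`k'` with `|k - k'| ≤ d`, with `B ↦ BΩ^d`, `C ↦ CΩ^d`, `N ↦ N + d` (smallness of `g₀` for the new
constants assumed). [cite: BauerschmidtBrydgesSlade2015Flow, Assumptions (A1)–(A2), Lemma 2.2 and §1.2] [cite: BauerschmidtBrydgesSlade2015LogCorr, §7.3 (proof of Proposition 7.1.1, Steps 2–3: frozen weights χ̃_j = χ_j(m̃²))] -/
theorem CutoffQuadHyp.shift {P : QuadFlowParams} {Ω : ℝ} {k : ℕ∞} {B c : ℝ} {N : ℕ} {C lam g₀ : ℝ}
    (h : CutoffQuadHyp P Ω k B c N C lam g₀) {k' : ℕ∞} {d : ℕ} (hk : k ≤ k' + d) (hk' : k' ≤ k + d)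
    {g : ℝ} (hg : 0 < g) (hg4 : g ≤ 1 / 4) (hsmallB : B * Ω ^ d * g ≤ 1 / 4)
    (hsmallN : 2 * (B * Ω ^ d) * g * ((N + d : ℕ) + 1 / (Ω - 1)) ≤ 1 / 2)
    (hsmallC1 : 4 * (C * Ω ^ d) * g ≤ 1)
    (hsmallC2 : 8 * (C * Ω ^ d) * g * ((N + d : ℕ) + 1 / (Ω - 1)) ≤ 1)
    (hsmallτ : 2 * (C * Ω ^ d) * g * (1 + 2 * (C * Ω ^ d) *
      ((1 + (N + d : ℕ)) / c + (N + d : ℕ) + 2 * Ω / (Ω - 1))) ≤ (lam - 1) / 2) :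
    CutoffQuadHyp P Ω k' (B * Ω ^ d) c (N + d) (C * Ω ^ d) lam g := by
  have hw : ∀ j, cutoffWeight Ω k j ≤ Ω ^ d * cutoffWeight Ω k' j := fun j =>
    cutoffWeight_le_pow_mul h.one_lt.le hk j
  have hC := h.C_nonneg
  have hmono : ∀ {u : ℝ} (j : ℕ), |u| ≤ C * cutoffWeight Ω k j → |u| ≤ C * Ω ^ d * cutoffWeight Ω k' j :=
    fun j hu => hu.trans (by rw [mul_assoc]; exact mul_le_mul_of_nonneg_left (hw j) hC)
  exact
    { toCutoffGbarHyp := h.toCutoffGbarHyp.shift hk hk' hg hg4 hsmallB hsmallN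
      one_lt_lam := h.one_lt_lam
      lam_le := h.lam_le
      C_nonneg := by have := h.one_lt; positivity
      zeta_exc := exc_shift hk' h.zeta_exc
      eta_le := fun j => hmono j (h.eta_le j)
      gamma_le := fun j => hmono j (h.gamma_le j)
      theta_le := fun j => hmono j (h.theta_le j)
      zeta_le := fun j => hmono j (h.zeta_le j)
      υgg_le := fun j => hmono j (h.υgg_le j)
      υgz_le := fun j => hmono j (h.υgz_le j)
      υgμ_le := fun j => hmono j (h.υgμ_le j)
      υzz_le := fun j => hmono j (h.υzz_le j)
      υzμ_le := fun j => hmono j (h.υzμ_le j)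
      smallC1 := hsmallC1
      smallC2 := hsmallC2
      smallτ := hsmallτ }

end CTWSAW

end Literature.Barriers.CriticalPhenomena
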